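import Summits.Ventures.DiscreteObjects.UnitDistance.RhombusChain13
import HarnessLib

/-!
# A 10-vertex 4-chromatic unit-distance graph over `ℚ(√3, √5)`: the closed chain of three rhombi (cell `pub-namedobj`, target (U), seat udg g24)

Framing (verbatim for the cell): lottery ticket; floor = certified bounds/negative ranges.

`RhombusChain13.lean` (this seat) gave a 13-vertex witness for `4 ≤ χ(ℚ(√3,√5)²)` — a closed chain of FOUR unit rhombi — and recorded that no closed
chain of three exists among the unit vectors of denominator `24` (the Φ-worlds of udg g21–g23).  The general criterion (THEORY-U24 §3: with the first
step `u₁ = 1`, a closed 3-chain exists over `K ∋ √3` iff some unit vector `(c, s) ∈ K²` makes `32 − 8√3·c − 12c²` a square in `K`) has a solution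
INSIDE `ℚ(√3,√5)` after all, in the denominator-`7` sector: `(c, s) = (4√3/7, ±1/7)` gives `32 − 96/7 − 576/49 = 320/49 = 5·(8/7)²`.  The resulting
10-VERTEX, 16-EDGE graph `R₁₀` has all coordinates of denominator `42`; the chain steps are `u₁ = 1`,
`u₂, u₃ = w/2 ± √5·(iw)` with `w = (−3/7, √3/21)`, and the closing unit vector is the Eisenstein unit `e₇ = (11/14, 5√3/14)`.  All its points lie in the
sub-world `x ∈ ℚ(√15)`, `y ∈ √3·ℚ(√15)` (THEORY-U21 §3: the `ℚ(√−3,√−5)`-world, local bound `≤ 4` at the prime over `2`), so `R₁₀`-configurations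
alone can never be 5-chromatic — the tight pieces must be MIXED with the Φ-worlds.  Smallest witnesses now: Moser's field 7 (spindle), `ℚ(√3,√5)` 10.

DATA / TEST.  `r10bpts` over denominator `42`; the integer unit test `unitStepBQ42` is `unitStepBQ35` of `PlaneSqrt3Sqrt5Four.lean` with `42² = 1764` in
place of `48² = 2304` (same coefficient functions `bqNorm0/3/5/15`).  Rhombi `{0,1,2,3}`, `{3,4,5,6}`, `{6,7,8,9}`; closing edge `0 ~ 9`.

THEOREMS.  `not_colorable_three_r10bGraph` (three diamonds + one edge), `colorable_four_r10bGraph`, `chromaticNumber_r10bGraph` (`= 4`), `r10b_card_edges`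
(`16` edges), the realisation `r10bHom : R₁₀ →g Γ(ℚ(√3,√5)²)` and `r10b_witness`.  Witness and mechanism: ours (seat analysis), not found in print —
PROVISIONAL.  `χ_gf(R₁₀) = 10/3` exact (MRVZ LP; FAMILIES-U24).
-/

namespace Summit.Ventures.DiscreteObjects.UnitDistance

open SimpleGraph

/-- Integer coordinate table of `R₁₀ ⊂ ℚ(√3,√5)²`: entry `((a,b,c,d),(e,f,g,h))` is `((a + b√3 + c√5 + d√15)/42, (e + f√3 + g√5 + h√15)/42)`. -/
def r10bpts : List ((ℤ × ℤ × ℤ × ℤ) × (ℤ × ℤ × ℤ × ℤ)) :=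
  [((0, 0, 0, 0), (0, 0, 0, 0)),
   ((42, 0, 0, 0), (0, 0, 0, 0)),
   ((21, 0, 0, 0), (0, 21, 0, 0)),
   ((63, 0, 0, 0), (0, 21, 0, 0)),
   ((54, 0, 0, -2), (0, 22, -18, 0)),
   ((57, 0, 0, 8), (0, 17, -12, 0)),
   ((48, 0, 0, 6), (0, 18, -30, 0)),
   ((39, 0, 0, 8), (0, 19, -12, 0)),
   ((42, 0, 0, -2), (0, 14, -18, 0)),
   ((33, 0, 0, 0), (0, 15, 0, 0))]

/-- Coordinates of vertex `v` of `R₁₀` (junk `0` beyond `10`). -/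
def r10bc (v : ℕ) : (ℤ × ℤ × ℤ × ℤ) × (ℤ × ℤ × ℤ × ℤ) := r10bpts.getD v ((0, 0, 0, 0), (0, 0, 0, 0))

/-- Exact unit-distance test over denominator `42`: the four basis coefficients of `(Δx)² + (Δy)²` are `(1764, 0, 0, 0)`. -/
def unitStepBQ42 (p q : (ℤ × ℤ × ℤ × ℤ) × (ℤ × ℤ × ℤ × ℤ)) : Bool :=
  (bqNorm0 (bqSub q.1 p.1) + bqNorm0 (bqSub q.2 p.2) == 1764) && (bqNorm3 (bqSub q.1 p.1) + bqNorm3 (bqSub q.2 p.2) == 0) &&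
    (bqNorm5 (bqSub q.1 p.1) + bqNorm5 (bqSub q.2 p.2) == 0) && (bqNorm15 (bqSub q.1 p.1) + bqNorm15 (bqSub q.2 p.2) == 0)

/-- The test never holds between a point and itself. -/
theorem unitStepBQ42_self (p : (ℤ × ℤ × ℤ × ℤ) × (ℤ × ℤ × ℤ × ℤ)) : unitStepBQ42 p p = false := by
  simp [unitStepBQ42, bqNorm0, bqSub]

/-- The test is symmetric. -/
theorem unitStepBQ42_comm (p q : (ℤ × ℤ × ℤ × ℤ) × (ℤ × ℤ × ℤ × ℤ)) : unitStepBQ42 p q = unitStepBQ42 q p := by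
  simp only [unitStepBQ42, bqNorm0_sub_comm q.1 p.1, bqNorm0_sub_comm q.2 p.2, bqNorm3_sub_comm q.1 p.1, bqNorm3_sub_comm q.2 p.2,
    bqNorm5_sub_comm q.1 p.1, bqNorm5_sub_comm q.2 p.2, bqNorm15_sub_comm q.1 p.1, bqNorm15_sub_comm q.2 p.2]

/-- THE WITNESS GRAPH `R₁₀` on `Fin 10`. -/
def r10bGraph : SimpleGraph (Fin 10) where
  Adj v w := unitStepBQ42 (r10bc v) (r10bc w) = true
  symm := ⟨fun v w h => by rw [unitStepBQ42_comm]; exact h⟩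
  loopless := ⟨fun v h => by rw [unitStepBQ42_self] at h; exact Bool.false_ne_true h⟩

/-- Adjacency of `R₁₀` is decidable. -/
instance : DecidableRel r10bGraph.Adj := fun v w => inferInstanceAs (Decidable (unitStepBQ42 (r10bc v) (r10bc w) = true))

/-- KERNEL FACT: the 16 edges (rhombi `{0,1,2,3}`, `{3,4,5,6}`, `{6,7,8,9}`, closing edge `0 ~ 9`). -/
theorem r10b_edges :
    r10bGraph.Adj 0 1 ∧ r10bGraph.Adj 0 2 ∧ r10bGraph.Adj 1 2 ∧ r10bGraph.Adj 3 1 ∧ r10bGraph.Adj 3 2 ∧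
    r10bGraph.Adj 3 4 ∧ r10bGraph.Adj 3 5 ∧ r10bGraph.Adj 4 5 ∧ r10bGraph.Adj 6 4 ∧ r10bGraph.Adj 6 5 ∧
    r10bGraph.Adj 6 7 ∧ r10bGraph.Adj 6 8 ∧ r10bGraph.Adj 7 8 ∧ r10bGraph.Adj 9 7 ∧ r10bGraph.Adj 9 8 ∧
    r10bGraph.Adj 0 9 := by
  unfold r10bGraph; decide

/-- `R₁₀` IS NOT 3-COLOURABLE: the three rhombi force vertices `3, 6, 9` to carry the colour of `0`, and `0 ~ 9`. -/
theorem not_colorable_three_r10bGraph : ¬ r10bGraph.Colorable 3 := by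
  rintro ⟨C⟩
  obtain ⟨h01, h02, h12, h31, h32, h34, h35, h45, h64, h65, h67, h68, h78, h97, h98, h09⟩ := r10b_edges
  have e3 : C 3 = C 0 := diamond_tip_eq C h01 h02 h12 h31 h32
  have e6 : C 6 = C 3 := diamond_tip_eq C h34 h35 h45 h64 h65
  have e9 : C 9 = C 6 := diamond_tip_eq C h67 h68 h78 h97 h98
  exact C.valid h09 (by rw [e9, e6, e3])

/-- An explicit proper 4-colouring of `R₁₀`. -/
def r10bcol4 : List (Fin 4) := [0, 1, 2, 0, 1, 2, 0, 1, 2, 3]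

/-- `R₁₀` is 4-colourable. -/
theorem colorable_four_r10bGraph : r10bGraph.Colorable 4 := by
  refine ⟨Coloring.mk (fun v => r10bcol4.getD v.val 0) ?_⟩
  intro v w hvw
  have key : ∀ v w : Fin 10, unitStepBQ42 (r10bc v) (r10bc w) = true → r10bcol4.getD v.val 0 ≠ r10bcol4.getD w.val 0 := by
    decide
  exact key v w hvw

/-- `χ(R₁₀) = 4`. -/
theorem chromaticNumber_r10bGraph : r10bGraph.chromaticNumber = 4 := by
  apply le_antisymm colorable_four_r10bGraph.chromaticNumber_le
  by_contra hlt
  have hlt' : r10bGraph.chromaticNumber < (3 : ℕ∞) + 1 := lt_of_not_ge hlt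
  have hle : r10bGraph.chromaticNumber ≤ (3 : ℕ) := Order.le_of_lt_add_one hlt'
  exact not_colorable_three_r10bGraph (chromaticNumber_le_iff_colorable.mp hle)

/-- KERNEL FACT: `R₁₀` has exactly `16` edges (`32` ordered adjacent pairs). -/
theorem r10b_card_edges : ((Finset.univ : Finset (Fin 10 × Fin 10)).filter fun p => r10bGraph.Adj p.1 p.2).card = 32 := by
  unfold r10bGraph; decide

end Summit.Ventures.DiscreteObjects.UnitDistance

noncomputable section

namespace Summit.Ventures.DiscreteObjects.UnitDistance

open SimpleGraph IntermediateField
open scoped IntermediateField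

/-- The real number `(a + b√3 + c√5 + d·√3·√5)/42` with integer data `(a, b, c, d)`. -/
def bqVal42 (x : ℤ × ℤ × ℤ × ℤ) : ℝ :=
  ((x.1 : ℝ) + (x.2.1 : ℝ) * Real.sqrt 3 + (x.2.2.1 : ℝ) * Real.sqrt 5 + (x.2.2.2 : ℝ) * (Real.sqrt 3 * Real.sqrt 5)) / 42

/-- The plane point with integer data over denominator `42`. -/
def ptBQ42 (p : (ℤ × ℤ × ℤ × ℤ) × (ℤ × ℤ × ℤ × ℤ)) : EuclideanSpace ℝ (Fin 2) :=
  !₂[bqVal42 p.1, bqVal42 p.2]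

/-- `bqVal42` of a difference is the difference of the values. -/
theorem bqVal42_sub (x y : ℤ × ℤ × ℤ × ℤ) : bqVal42 x - bqVal42 y = bqVal42 (bqSub x y) := by
  simp only [bqVal42, bqSub]; push_cast; ring

/-- The square of `bqVal42 x` on the basis `1, √3, √5, √3√5` (denominator `1764 = 42²`). -/
theorem bqVal42_sq (x : ℤ × ℤ × ℤ × ℤ) : bqVal42 x ^ 2 =
    ((bqNorm0 x : ℝ) + (bqNorm3 x : ℝ) * Real.sqrt 3 + (bqNorm5 x : ℝ) * Real.sqrt 5 +
      (bqNorm15 x : ℝ) * (Real.sqrt 3 * Real.sqrt 5)) / 1764 := by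
  rw [bqVal42, div_pow, bqNum_sq]; norm_num

/-- The integer unit test gives `(Δx)² + (Δy)² = 1`. -/
theorem bqVal42_sq_add_sq_eq_one {p q : (ℤ × ℤ × ℤ × ℤ) × (ℤ × ℤ × ℤ × ℤ)} (h : unitStepBQ42 p q = true) :
    (bqVal42 q.1 - bqVal42 p.1) ^ 2 + (bqVal42 q.2 - bqVal42 p.2) ^ 2 = 1 := by
  simp only [unitStepBQ42, Bool.and_eq_true, beq_iff_eq] at h
  obtain ⟨⟨⟨h0, h3⟩, h5⟩, h15⟩ := h
  have h0' : (bqNorm0 (bqSub q.1 p.1) : ℝ) + (bqNorm0 (bqSub q.2 p.2) : ℝ) = 1764 := by exact_mod_cast h0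
  have h3' : (bqNorm3 (bqSub q.1 p.1) : ℝ) + (bqNorm3 (bqSub q.2 p.2) : ℝ) = 0 := by exact_mod_cast h3
  have h5' : (bqNorm5 (bqSub q.1 p.1) : ℝ) + (bqNorm5 (bqSub q.2 p.2) : ℝ) = 0 := by exact_mod_cast h5
  have h15' : (bqNorm15 (bqSub q.1 p.1) : ℝ) + (bqNorm15 (bqSub q.2 p.2) : ℝ) = 0 := by exact_mod_cast h15
  rw [bqVal42_sub, bqVal42_sub, bqVal42_sq, bqVal42_sq]
  linear_combination (h0' + Real.sqrt 3 * h3' + Real.sqrt 5 * h5' + (Real.sqrt 3 * Real.sqrt 5) * h15') / 1764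

/-- The integer unit test implies unit distance. -/
theorem dist_ptBQ42_eq_one {p q : (ℤ × ℤ × ℤ × ℤ) × (ℤ × ℤ × ℤ × ℤ)} (h : unitStepBQ42 p q = true) :
    dist (ptBQ42 p) (ptBQ42 q) = 1 := by
  have aux := bqVal42_sq_add_sq_eq_one h
  have aux' : (bqVal42 p.1 - bqVal42 q.1) ^ 2 + (bqVal42 p.2 - bqVal42 q.2) ^ 2 = 1 := by linear_combination aux
  have hd : dist (ptBQ42 p) (ptBQ42 q) ^ 2 = 1 := by
    rw [EuclideanSpace.dist_sq_eq, Fin.sum_univ_two, Real.dist_eq, Real.dist_eq, sq_abs, sq_abs]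
    simp [ptBQ42]
    linear_combination aux'
  exact (pow_eq_one_iff_of_nonneg dist_nonneg two_ne_zero).1 hd

/-- Every value `bqVal42 x` lies in `ℚ(√3, √5)`. -/
theorem bqVal42_mem (x : ℤ × ℤ × ℤ × ℤ) : bqVal42 x ∈ multiSqrtField {3, 5} := by
  obtain ⟨h3, h5⟩ := sqrt3_sqrt5_mem
  unfold bqVal42
  refine div_mem ?_ (ofNat_mem _ 42)
  exact add_mem (add_mem (add_mem (intCast_mem _ _) (mul_mem (intCast_mem _ _) h3)) (mul_mem (intCast_mem _ _) h5))
    (mul_mem (intCast_mem _ _) (mul_mem h3 h5))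

/-- Every point `ptBQ42 p` lies in `ℚ(√3, √5)²`. -/
theorem ptBQ42_mem (p : (ℤ × ℤ × ℤ × ℤ) × (ℤ × ℤ × ℤ × ℤ)) : ptBQ42 p ∈ fieldPoints (multiSqrtField {3, 5}) := by
  intro i
  fin_cases i
  · exact bqVal42_mem p.1
  · exact bqVal42_mem p.2

/-- The realisation homomorphism `R₁₀ →g Γ(ℚ(√3,√5)²)`, `v ↦ ptBQ42 (r10bc v)`. -/
def r10bHom : r10bGraph →g planeUnitDistanceGraph.induce (fieldPoints (multiSqrtField {3, 5})) where
  toFun v := ⟨ptBQ42 (r10bc v), ptBQ42_mem _⟩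
  map_rel' h := dist_ptBQ42_eq_one h

/-- THE 10-VERTEX WITNESS: a 4-chromatic graph on `10` vertices with a unit-distance realisation in `ℚ(√3,√5)²`. -/
theorem r10b_witness : r10bGraph.chromaticNumber = 4 ∧
    Nonempty (r10bGraph →g planeUnitDistanceGraph.induce (fieldPoints (multiSqrtField {3, 5}))) :=
  ⟨chromaticNumber_r10bGraph, ⟨r10bHom⟩⟩

end Summit.Ventures.DiscreteObjects.UnitDistance
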